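import Summits.AtomisticToContinuum.Crystallization.Theorems.FrustratedLawDichotomyStrainedPatchHomEntryTable
import Summits.AtomisticToContinuum.Crystallization.Theorems.FrustratedLawDichotomyStrainedPatchHomEntryFitHcp

/-!
# CERTIFICATE BY DETERMINISTIC SEARCH: `searchOK` (the bisection tree is generated, never stored), `∃ t, treeOK …` from a passing search,
# shard glue, the native leaf-count instrument `searchLeaves`, coordinate selectors, and `(H) HomFloor m` from two SEARCH Booleans

decomp-a2c hand-1 g21 (crux `AperiodicFrustratedLawGap`, stmt-AtomisticToContinuum-27623; sequel of `…HomEntryTable`; critic rows 817 (4) / 825 / 828 (B) /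
829 (A) / 834).  hand-2's `(H)` line ends in `homFloor_of_entryFitTrees : … → treeOK (entryLeafOKF μ) tF rootC rootW = true → treeOK (entryLeafOKH2 μ) tH
rootCH rootWH = true → HomFloor m` for LITERAL trees `tF`, `tH : CertTree _`, to be emitted by the census search (H-FCC-COUNT / H-HCP-COUNT).  A literal
tree of `N` leaves is ≈ `20·N` bytes of Lean source; proposals are capped at 256 KB, so beyond `N ≈ 10⁴` a literal certificate cannot even be filed.
This module removes the literal: the tree is RE-GENERATED inside Lean by a deterministic bisection search with a fixed coordinate selector, and only
ONE Boolean per family (or per shard) is asserted.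

* §1 `searchOK verdict sel fuel d c w` — try the leaf verdict on the box `(c, w)`; if it fails and fuel remains, bisect coordinate `k = sel d c w`
  (exact integer halving, `w k` even) and recurse on both halves at depth `d + 1`.  ★ `exists_tree_of_searchOK : searchOK … c w = true → ∃ t,
  treeOK verdict t c w = true` (induction on fuel) — so EVERY tree theorem (`fccHalf_of_entryTree`, `hcpHalf_of_entryTree`, …) applies unchanged;
  shard glue `exists_tree_leaf` / `exists_tree_split` (assemble `∃ t` facts proved on sub-boxes, e.g. one `native_decide` per shard file);
* §2 the COUNT instrument `searchLeaves verdict sel fuel d c w : ℕ` (number of leaves of the generated tree, `0` = failure) with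
  ★ `searchOK_of_searchLeaves_ne_zero` — the census's native run `#eval searchLeaves (entryLeafOKT muRec) rr9 fuel 0 rootC rootW` IS the certificate
  check (same function, zero porting), and its value is `N_β` for the budget rule of rows 817 (4)/825;
* §3 selectors: `pick order w` = the first WIDEST coordinate in a fixed order (= round robin from a cube root, and the sensible choice on shard
  boxes), `rr9` (fcc entry cube: diagonal entries first), `rr12` (hcp entry + shuffle cube);
* §4 the `(H)` instances: ★★ `fccHalf_of_entrySearch` / `hcpHalf_of_entrySearch` (generic verdict + `hver`, search on the root cube ⟹ `hfcc` / `hhcp` of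
  `…HomPrunedPolar.homFloor_of_prunedBoxSums_selfAdjoint` verbatim) and ★★★ `homFloor_of_entrySearches : 2(m + e_W)SC ≤ μ →
  searchOK (entryLeafOKT μ) selF fuelF dF rootC rootW = true → searchOK (entryLeafOKH2 μ) selH fuelH dH rootCH rootWH = true → HomFloor m`
  (table checker (P4) + fit (P1) on the fcc side, hand-2's `entryLeafOKH2` on the hcp side), plus the `entryLeafOKF` twin `homFloor_of_entrySearchesF`;
* §5 kernel smoke tests on a toy verdict and on the real fcc verdict at a box the fit prune closes at depth 0.

All definitions computable; 0 sorry; standard axioms; no instances / notation / `#eval`.  `--supports stmt-AtomisticToContinuum-27623`.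
-/

namespace Summit.AtomisticToContinuum.Crystallization.Theorems.FrustratedLawDichotomyStrainedPatchHomEntrySearch

open scoped BigOperators RealInnerProductSpace
open Literature.Analysis.ValidatedNumerics.Numerics
open Summit.AtomisticToContinuum.Crystallization.Theorems.ChargedEnergyGapNegative (E3)
open Summit.AtomisticToContinuum.Crystallization.Theorems.FrustratedLawDichotomySchurCut (effPot w₄₅ ω₄)
open Summit.AtomisticToContinuum.Crystallization.Theorems.FrustratedLawDichotomyAveragingRuleTightFree (TightNearCap BadNearCap)
open Summit.AtomisticToContinuum.Crystallization.Theorems.FrustratedLawDichotomyExemptAbsorption (ExemptNear)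
open Summit.AtomisticToContinuum.Crystallization.Theorems.FrustratedLawDichotomyStrainedPatchHomSplit
open Summit.AtomisticToContinuum.Crystallization.Theorems.FrustratedLawDichotomyStrainedPatchHomPrunedPolar (homFloor_of_prunedBoxSums_selfAdjoint)
open Summit.AtomisticToContinuum.Crystallization.Theorems.FrustratedLawDichotomyStrainedPatchHomCertTree (CertTree treeOK)
open Summit.AtomisticToContinuum.Crystallization.Theorems.FrustratedLawDichotomyStrainedPatchHomEntryGram
open Summit.AtomisticToContinuum.Crystallization.Theorems.FrustratedLawDichotomyStrainedPatchHomEntryFit (entryLeafOKF entryLeafOKF_sound)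
open Summit.AtomisticToContinuum.Crystallization.Theorems.FrustratedLawDichotomyStrainedPatchHomEntryGramHcp (rootCH rootWH hcpHalf_of_entryTree)
open Summit.AtomisticToContinuum.Crystallization.Theorems.FrustratedLawDichotomyStrainedPatchHomEntryFitHcp (entryLeafOKH2 entryLeafOKH2_sound)
open Summit.AtomisticToContinuum.Crystallization.Theorems.FrustratedLawDichotomyStrainedPatchHomEntryTable (entryLeafOKT entryLeafOKT_sound muRec)
open Literature.Barriers.AtomisticToContinuum.FlatleyTheil2015 (fccVec)

/-! ## §1. The search, and a tree from a passing search -/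

/-- ★ **CERTIFICATE BY SEARCH.**  `searchOK verdict sel fuel d c w`: accept the box `(c, w)` (scaled integers, real box `|xᵢ − cᵢ/SC| ≤ wᵢ/SC`) if the
leaf verdict passes; otherwise, if `fuel` remains, bisect the coordinate `k = sel d c w` (only if `w k` is even, so the halving is exact) and accept iff
both halves are accepted with one unit of fuel less at depth `d + 1`.  The generated tree is exactly a `CertTree` run by `treeOK`. -/
def searchOK {κ : Type} [DecidableEq κ] (verdict : (κ → ℤ) → (κ → ℤ) → Bool) (sel : ℕ → (κ → ℤ) → (κ → ℤ) → κ) :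
    ℕ → ℕ → (κ → ℤ) → (κ → ℤ) → Bool
  | 0, _, c, w => verdict c w
  | fuel + 1, d, c, w => verdict c w ||
      (decide (w (sel d c w) % 2 = 0) &&
        searchOK verdict sel fuel (d + 1) (Function.update c (sel d c w) (c (sel d c w) - w (sel d c w) / 2))
            (Function.update w (sel d c w) (w (sel d c w) / 2)) &&
        searchOK verdict sel fuel (d + 1) (Function.update c (sel d c w) (c (sel d c w) + w (sel d c w) / 2))
            (Function.update w (sel d c w) (w (sel d c w) / 2)))

/-- A passing leaf verdict is a one-leaf tree. [formal bookkeeping] -/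
theorem exists_tree_leaf {κ : Type} [DecidableEq κ] {verdict : (κ → ℤ) → (κ → ℤ) → Bool} {c w : κ → ℤ} (h : verdict c w = true) :
    ∃ t : CertTree κ, treeOK verdict t c w = true :=
  ⟨.leaf, by simpa [treeOK] using h⟩

/-- ★ **SHARD GLUE**: trees on the two halves of an exact bisection give a tree on the box. [formal bookkeeping] -/
theorem exists_tree_split {κ : Type} [DecidableEq κ] {verdict : (κ → ℤ) → (κ → ℤ) → Bool} {c w : κ → ℤ} (k : κ) (hev : w k % 2 = 0)
    (hl : ∃ t : CertTree κ, treeOK verdict t (Function.update c k (c k - w k / 2)) (Function.update w k (w k / 2)) = true)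
    (hr : ∃ t : CertTree κ, treeOK verdict t (Function.update c k (c k + w k / 2)) (Function.update w k (w k / 2)) = true) :
    ∃ t : CertTree κ, treeOK verdict t c w = true := by
  obtain ⟨tl, htl⟩ := hl
  obtain ⟨tr, htr⟩ := hr
  exact ⟨.split k tl tr, by simp [treeOK, hev, htl, htr]⟩

/-- ★ **A PASSING SEARCH YIELDS A CERTIFICATE TREE** (the tree the search generated), so every `treeOK`-theorem applies. [folklore] -/
theorem exists_tree_of_searchOK {κ : Type} [DecidableEq κ] (verdict : (κ → ℤ) → (κ → ℤ) → Bool) (sel : ℕ → (κ → ℤ) → (κ → ℤ) → κ) :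
    ∀ (fuel d : ℕ) (c w : κ → ℤ), searchOK verdict sel fuel d c w = true → ∃ t : CertTree κ, treeOK verdict t c w = true := by
  intro fuel
  induction fuel with
  | zero =>
    intro d c w h
    exact exists_tree_leaf (by simpa [searchOK] using h)
  | succ n ih =>
    intro d c w h
    simp only [searchOK, Bool.or_eq_true, Bool.and_eq_true, decide_eq_true_eq] at h
    rcases h with h | ⟨⟨hev, hl⟩, hr⟩
    · exact exists_tree_leaf h
    · exact exists_tree_split (sel d c w) hev (ih _ _ _ hl) (ih _ _ _ hr)

/-! ## §2. The leaf-count instrument -/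

/-- ★ **LEAF COUNT of the generated tree** (`0` = the search FAILS within the fuel): the native instrument for `N_β`.  Same recursion as `searchOK`. -/
def searchLeaves {κ : Type} [DecidableEq κ] (verdict : (κ → ℤ) → (κ → ℤ) → Bool) (sel : ℕ → (κ → ℤ) → (κ → ℤ) → κ) :
    ℕ → ℕ → (κ → ℤ) → (κ → ℤ) → ℕ
  | 0, _, c, w => if verdict c w then 1 else 0
  | fuel + 1, d, c, w =>
      if verdict c w then 1 else
        if w (sel d c w) % 2 = 0 then
          (match searchLeaves verdict sel fuel (d + 1) (Function.update c (sel d c w) (c (sel d c w) - w (sel d c w) / 2))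
              (Function.update w (sel d c w) (w (sel d c w) / 2)) with
            | 0 => 0
            | nl + 1 =>
              match searchLeaves verdict sel fuel (d + 1) (Function.update c (sel d c w) (c (sel d c w) + w (sel d c w) / 2))
                  (Function.update w (sel d c w) (w (sel d c w) / 2)) with
              | 0 => 0
              | nr + 1 => nl + 1 + (nr + 1))
        else 0

/-- ★ **A NON-ZERO COUNT IS A PASSING SEARCH** (so the census's native count run is itself the certificate check). [formal bookkeeping] -/
theorem searchOK_of_searchLeaves_ne_zero {κ : Type} [DecidableEq κ] (verdict : (κ → ℤ) → (κ → ℤ) → Bool) (sel : ℕ → (κ → ℤ) → (κ → ℤ) → κ) :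
    ∀ (fuel d : ℕ) (c w : κ → ℤ), searchLeaves verdict sel fuel d c w ≠ 0 → searchOK verdict sel fuel d c w = true := by
  intro fuel
  induction fuel with
  | zero =>
    intro d c w h
    simp only [searchLeaves, ne_eq, ite_eq_right_iff, Classical.not_imp] at h
    simpa [searchOK] using h.1
  | succ n ih =>
    intro d c w h
    simp only [searchOK, Bool.or_eq_true, Bool.and_eq_true, decide_eq_true_eq]
    by_cases hv : verdict c w = true
    · exact Or.inl hv
    · right
      simp only [searchLeaves, hv, Bool.false_eq_true, ↓reduceIte] at h
      by_cases hev : w (sel d c w) % 2 = 0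
      · refine ⟨⟨hev, ?_⟩, ?_⟩
        · refine ih _ _ _ fun h0 => h ?_
          simp [hev, h0]
        · refine ih _ _ _ fun h0 => h ?_
          simp only [hev, ↓reduceIte, h0]
          split <;> rfl
      · exact (h (by simp [hev])).elim

/-! ## §3. Coordinate selectors -/

/-- The first coordinate of `order` with the largest half-width (`dflt` if `order` is empty). -/
def pick {κ : Type} (dflt : κ) (order : List κ) (w : κ → ℤ) : κ :=
  order.foldl (fun best k => if w best < w k then k else best) (order.headD dflt)

/-- The nine fcc ENTRY coordinates, diagonal first. -/
def order9 : List (Fin 3 × Fin 3) := [(0, 0), (1, 1), (2, 2), (0, 1), (1, 0), (0, 2), (2, 0), (1, 2), (2, 1)]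

/-- ★ Selector for the fcc entry cube: widest coordinate, diagonal entries preferred on ties (= round robin from the cube root `rootW`). -/
def rr9 : ℕ → (Fin 3 × Fin 3 → ℤ) → (Fin 3 × Fin 3 → ℤ) → Fin 3 × Fin 3 := fun _ _ w => pick (0, 0) order9 w

/-- The twelve hcp ENTRY + SHUFFLE coordinates, diagonal entries first, shuffle last. -/
def order12 : List ((Fin 3 × Fin 3) ⊕ Fin 3) :=
  [Sum.inl (0, 0), Sum.inl (1, 1), Sum.inl (2, 2), Sum.inl (0, 1), Sum.inl (1, 0), Sum.inl (0, 2), Sum.inl (2, 0), Sum.inl (1, 2),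
    Sum.inl (2, 1), Sum.inr 0, Sum.inr 1, Sum.inr 2]

/-- ★ Selector for the hcp entry + shuffle cube: widest coordinate in the order `order12`. -/
def rr12 : ℕ → ((Fin 3 × Fin 3) ⊕ Fin 3 → ℤ) → ((Fin 3 × Fin 3) ⊕ Fin 3 → ℤ) → (Fin 3 × Fin 3) ⊕ Fin 3 :=
  fun _ _ w => pick (Sum.inl (0, 0)) order12 w

/-! ## §4. The `(H)` instances -/

/-- ★★ **THE fcc HALF FROM ONE SEARCH BOOLEAN** (generic verdict): a leaf verdict sound in the sense of `…HomEntryGram.fccHalf_of_entryTree`'s `hver` and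
a passing search on the root cube give the fcc hypothesis `hfcc` of `…HomPrunedPolar.homFloor_of_prunedBoxSums_selfAdjoint`, verbatim. [folklore] -/
theorem fccHalf_of_entrySearch {m : ℝ} {μ : ℤ} (hμ : 2 * (m + (-(7175 / 10000) + 3 / 400)) * SC ≤ μ)
    (verdict : (Fin 3 × Fin 3 → ℤ) → (Fin 3 × Fin 3 → ℤ) → Bool)
    (hver : ∀ c w, verdict c w = true → ∀ U : E3 →L[ℝ] E3, (∀ v v' : E3, ⟪U v, v'⟫ = ⟪v, U v'⟫) → ‖U - 1‖ ≤ 1 / 4 →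
      (∀ ab : Fin 3 × Fin 3, |(U (EuclideanSpace.single ab.2 (1 : ℝ))) ab.1 - (c ab : ℝ) / SC| ≤ (w ab : ℝ) / SC) →
      (∀ (M : ℕ) (z : Fin M → E3) (c : Fin M), Function.Injective z →
          Set.range z = {x : E3 | dist x (z c) ≤ 133 / 10 ∧ ∃ a : Fin 3 → ℤ, x = z c + latPt U fccVec a} →
          TightNearCap (9 / 5) (3 / 2) z c ∨ ExemptNear (9 / 5) ExRec z c ∨ BadNearCap (9 / 5) (3 / 2) z c) ∨
        (μ : ℝ) / SC ≤ ∑ b ∈ (Fintype.piFinset fun _ : Fin 3 => Finset.Icc (-7 : ℤ) 7).filter (fun b => b ≠ 0),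
          effPot w₄₅ ω₄ (3 / 400) ‖latPt U fccVec b‖)
    {sel : ℕ → (Fin 3 × Fin 3 → ℤ) → (Fin 3 × Fin 3 → ℤ) → Fin 3 × Fin 3} {fuel d : ℕ} (h : searchOK verdict sel fuel d rootC rootW = true) :
    ∀ U : E3 →L[ℝ] E3, (∀ v w : E3, inner ℝ (U v) w = inner ℝ v (U w)) → (∀ w : E3, 0 ≤ inner ℝ w (U w)) → ‖U - 1‖ ≤ 1 / 4 →
      (∀ (M : ℕ) (z : Fin M → E3) (c : Fin M), Function.Injective z →
          Set.range z = {x : E3 | dist x (z c) ≤ 133 / 10 ∧ ∃ a : Fin 3 → ℤ, x = z c + latPt U fccVec a} →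
          TightNearCap (9 / 5) (3 / 2) z c ∨ ExemptNear (9 / 5) ExRec z c ∨ BadNearCap (9 / 5) (3 / 2) z c) ∨
      m ≤ (∑ b ∈ (Fintype.piFinset fun _ : Fin 3 => Finset.Icc (-7 : ℤ) 7).filter (fun b => b ≠ 0),
        effPot w₄₅ ω₄ (3 / 400) ‖latPt U fccVec b‖) / 2 - (-(7175 / 10000) + 3 / 400) := by
  obtain ⟨t, ht⟩ := exists_tree_of_searchOK verdict sel fuel d rootC rootW h
  exact fccHalf_of_entryTree hμ verdict hver ht

/-- ★★ **THE hcp HALF FROM ONE SEARCH BOOLEAN** (generic verdict): twin of `…HomEntryGramHcp.hcpHalf_of_entryTree` for a passing search on the hcp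
root cube `(rootCH, rootWH)`. [folklore] -/
theorem hcpHalf_of_entrySearch {m : ℝ} {μ : ℤ} (hμ : 2 * (m + (-(7175 / 10000) + 3 / 400)) * SC ≤ μ)
    (verdict : ((Fin 3 × Fin 3) ⊕ Fin 3 → ℤ) → ((Fin 3 × Fin 3) ⊕ Fin 3 → ℤ) → Bool)
    (hver : ∀ c w, verdict c w = true → ∀ (U : E3 →L[ℝ] E3) (ξ : E3), (∀ v v' : E3, ⟪U v, v'⟫ = ⟪v, U v'⟫) → ‖U - 1‖ ≤ 1 / 4 →
      (∀ ab : Fin 3 × Fin 3, |(U (EuclideanSpace.single ab.2 (1 : ℝ))) ab.1 - (c (Sum.inl ab) : ℝ) / SC| ≤ (w (Sum.inl ab) : ℝ) / SC) →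
      (∀ i : Fin 3, |ξ i - (c (Sum.inr i) : ℝ) / SC| ≤ (w (Sum.inr i) : ℝ) / SC) →
      (∀ (M : ℕ) (z : Fin M → E3) (c : Fin M), Function.Injective z →
          Set.range z = {x : E3 | dist x (z c) ≤ 133 / 10 ∧ ∃ a : Fin 3 → ℤ,
            x = z c + latPt U hexFrame a ∨ x = z c + latPt U hexFrame a + U (hcpShift + ξ)} →
          TightNearCap (9 / 5) (3 / 2) z c ∨ ExemptNear (9 / 5) ExRec z c ∨ BadNearCap (9 / 5) (3 / 2) z c) ∨
        (μ : ℝ) / SC ≤ ∑ b ∈ (Fintype.piFinset fun _ : Fin 3 => Finset.Icc (-7 : ℤ) 7).filter (fun b => b ≠ 0), effPot w₄₅ ω₄ (3 / 400) ‖latPt U hexFrame b‖ +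
          ∑ b ∈ (Fintype.piFinset fun _ : Fin 3 => Finset.Icc (-7 : ℤ) 7), effPot w₄₅ ω₄ (3 / 400) ‖latPt U hexFrame b + U (hcpShift + ξ)‖)
    {sel : ℕ → ((Fin 3 × Fin 3) ⊕ Fin 3 → ℤ) → ((Fin 3 × Fin 3) ⊕ Fin 3 → ℤ) → (Fin 3 × Fin 3) ⊕ Fin 3} {fuel d : ℕ}
    (h : searchOK verdict sel fuel d rootCH rootWH = true) :
    ∀ (U : E3 →L[ℝ] E3) (ξ : E3), (∀ v w : E3, inner ℝ (U v) w = inner ℝ v (U w)) → (∀ w : E3, 0 ≤ inner ℝ w (U w)) →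
      ‖U - 1‖ ≤ 1 / 4 → ‖ξ‖ ≤ 1 / 4 →
      (∀ (M : ℕ) (z : Fin M → E3) (c : Fin M), Function.Injective z →
          Set.range z = {x : E3 | dist x (z c) ≤ 133 / 10 ∧ ∃ a : Fin 3 → ℤ,
            x = z c + latPt U hexFrame a ∨ x = z c + latPt U hexFrame a + U (hcpShift + ξ)} →
          TightNearCap (9 / 5) (3 / 2) z c ∨ ExemptNear (9 / 5) ExRec z c ∨ BadNearCap (9 / 5) (3 / 2) z c) ∨
      m ≤ (∑ b ∈ (Fintype.piFinset fun _ : Fin 3 => Finset.Icc (-7 : ℤ) 7).filter (fun b => b ≠ 0),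
          effPot w₄₅ ω₄ (3 / 400) ‖latPt U hexFrame b‖ +
        ∑ b ∈ (Fintype.piFinset fun _ : Fin 3 => Finset.Icc (-7 : ℤ) 7),
          effPot w₄₅ ω₄ (3 / 400) ‖latPt U hexFrame b + U (hcpShift + ξ)‖) / 2 - (-(7175 / 10000) + 3 / 400) := by
  obtain ⟨t, ht⟩ := exists_tree_of_searchOK verdict sel fuel d rootCH rootWH h
  exact hcpHalf_of_entryTree hμ verdict hver ht

/-- ★★★ **`(H) HomFloor m` FROM TWO SEARCH BOOLEANS**: fcc side = (P1) fit ∨ symmetry ∨ column ∨ TABLE (P4) (`…HomEntryTable.entryLeafOKT`), hcp side =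
hand-2's `entryLeafOKH2` ((P1) fit ∨ symmetry ∨ column ∨ (P4)); any selectors, fuels and start depths.  With `m = 1/625` and `μ = muRec` the first
hypothesis is `…HomEntryTable.muRec_ok`. [folklore] -/
theorem homFloor_of_entrySearches {m : ℝ} {μ : ℤ} (hμ : 2 * (m + (-(7175 / 10000) + 3 / 400)) * SC ≤ μ)
    {selF : ℕ → (Fin 3 × Fin 3 → ℤ) → (Fin 3 × Fin 3 → ℤ) → Fin 3 × Fin 3} {fuelF dF : ℕ}
    (hF : searchOK (entryLeafOKT μ) selF fuelF dF rootC rootW = true)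
    {selH : ℕ → ((Fin 3 × Fin 3) ⊕ Fin 3 → ℤ) → ((Fin 3 × Fin 3) ⊕ Fin 3 → ℤ) → (Fin 3 × Fin 3) ⊕ Fin 3} {fuelH dH : ℕ}
    (hH : searchOK (entryLeafOKH2 μ) selH fuelH dH rootCH rootWH = true) : HomFloor m :=
  homFloor_of_prunedBoxSums_selfAdjoint
    (fccHalf_of_entrySearch hμ (entryLeafOKT μ) (fun _ _ hv U hsa hU hbox => entryLeafOKT_sound hv U hsa hU hbox) hF)
    (hcpHalf_of_entrySearch hμ (entryLeafOKH2 μ) (fun _ _ hv U ξ hsa hU hbox hξ => entryLeafOKH2_sound hv U ξ hsa hU hbox hξ) hH)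

/-- ★★★ The twin with hand-2's fcc verdict `entryLeafOKF` ((P1) ∨ symmetry ∨ column ∨ box checker (P4)) — natively equivalent, kernel-expensive. [folklore] -/
theorem homFloor_of_entrySearchesF {m : ℝ} {μ : ℤ} (hμ : 2 * (m + (-(7175 / 10000) + 3 / 400)) * SC ≤ μ)
    {selF : ℕ → (Fin 3 × Fin 3 → ℤ) → (Fin 3 × Fin 3 → ℤ) → Fin 3 × Fin 3} {fuelF dF : ℕ}
    (hF : searchOK (entryLeafOKF μ) selF fuelF dF rootC rootW = true)
    {selH : ℕ → ((Fin 3 × Fin 3) ⊕ Fin 3 → ℤ) → ((Fin 3 × Fin 3) ⊕ Fin 3 → ℤ) → (Fin 3 × Fin 3) ⊕ Fin 3} {fuelH dH : ℕ}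
    (hH : searchOK (entryLeafOKH2 μ) selH fuelH dH rootCH rootWH = true) : HomFloor m :=
  homFloor_of_prunedBoxSums_selfAdjoint
    (fccHalf_of_entrySearch hμ (entryLeafOKF μ) (fun _ _ hv U hsa hU hbox => entryLeafOKF_sound hv U hsa hU hbox) hF)
    (hcpHalf_of_entrySearch hμ (entryLeafOKH2 μ) (fun _ _ hv U ξ hsa hU hbox hξ => entryLeafOKH2_sound hv U ξ hsa hU hbox hξ) hH)

/-! ## §5. Kernel smoke tests -/

/-- Toy verdict «half-width of coordinate `0` at most `2`» on one coordinate: from half-width `8` the search needs depth `2` (fails with fuel `1`,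
passes with fuel `2` generating `4` leaves, `searchLeaves` agrees); `pick` takes the widest coordinate and prefers the earlier one on ties. -/
example : searchOK (fun _ w : Fin 1 → ℤ => decide (w 0 ≤ 2)) (fun _ _ _ => 0) 1 0 (fun _ => 0) (fun _ => 8) = false ∧
    searchOK (fun _ w : Fin 1 → ℤ => decide (w 0 ≤ 2)) (fun _ _ _ => 0) 2 0 (fun _ => 0) (fun _ => 8) = true ∧
    searchLeaves (fun _ w : Fin 1 → ℤ => decide (w 0 ≤ 2)) (fun _ _ _ => 0) 2 0 (fun _ => 0) (fun _ => 8) = 4 ∧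
    searchLeaves (fun _ w : Fin 1 → ℤ => decide (w 0 ≤ 2)) (fun _ _ _ => 0) 1 0 (fun _ => 0) (fun _ => 8) = 0 ∧
    rr9 0 rootC rootW = (0, 0) ∧ rr9 0 rootC (Function.update rootW (2, 0) (2 * rootW (2, 0))) = (2, 0) ∧
    rr12 0 rootCH rootWH = Sum.inl (0, 0) := by
  decide +kernel

/-- The real fcc verdict at the thin box `U = 0.97·1 ± 2⁻⁸`: the fit prune closes it at depth `0`, so the search passes with fuel `0` and counts one leaf. -/
example : searchOK (entryLeafOKT muRec) rr9 0 0 (fun ab => if ab.1 = ab.2 then 273030727409336 else 0) (fun _ => 1099511627776) = true ∧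
    searchLeaves (entryLeafOKT muRec) rr9 3 0 (fun ab => if ab.1 = ab.2 then 273030727409336 else 0) (fun _ => 1099511627776) = 1 := by
  decide +kernel

end Summit.AtomisticToContinuum.Crystallization.Theorems.FrustratedLawDichotomyStrainedPatchHomEntrySearch
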